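import Literature.Analysis.FluidPDE.LeiZhang2011Energy
import Literature.Analysis.FluidPDE.LeiZhang2011SliceEstimates
import HarnessLib

/-!
# Lei–Zhang 2011, §2: the energy inequality (2.4) in time-integrated form

Analysis/FluidPDE proofs file (theorems only), on the discharge path of the named fact
`Literature.Analysis.FluidPDE.LeiZhang2011_liouville` (Z. Lei, Q. S. Zhang, J. Funct. Anal. 261
(2011) = arXiv:1011.5066, Theorem 1.2 via Theorem 1.1, §2 (2.4)). From the energy identity
(`LeiZhang2011.energy_identity`) and the slice estimates of the cut-off terms
(`LeiZhang2011SliceEstimates`): for a convex `H ∈ C²`, `H ≥ 0`, `H(0) = 0`, `H'² ≤ κ H H''`,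
a radially non-increasing axisymmetric cut-off `φ ∈ C²_c` (`φ ∂ᵣφ ≤ 0`) and a time cut-off
`η ∈ C¹`, `η ≥ 0`, `η(t₁) = 0`, and `0 < ε`,

`η(t₂) ∫ H(F(t₂)) φ² + (1 − 2ε) ∫_{t₁}^{t₂} η ∫ H''(F)‖∇F‖²φ²`
`  ≤ ∫_{t₁}^{t₂} ( η (κ/ε) (∫ H(F)‖∇φ‖² + ∫ H(F)‖B − c‖²‖∇φ‖²) + |η'| ∫ H(F) φ² ) ds`

(`LeiZhang2011.energy_inequality`): the form of (2.3)–(2.4) before the Hölder/John–Nirenberg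
step on the stream-function term (`integral_comp_mul_norm_sub_sq_mul_norm_gradient_sq_le`,
`exists_eLpNorm_sub_average_le`) and before Sobolev. For `H(v) = |v|^{2q}` the good term
`∫ H''(F)‖∇F‖²φ²` is `(4 − 2/q) ∫ |∇f|² φ²`, `f = |F|^q`, as in the paper.

## References

* Z. Lei, Q. S. Zhang, J. Funct. Anal. 261 (2011) = arXiv:1011.5066, §2 (2.3)–(2.4), pp. 6–7.
  [LeiZhang2011]
-/

noncomputable section

open MeasureTheory Set Function Filter Metric intervalIntegral
open _root_.Topology
open scoped InnerProductSpace RealInnerProductSpace NNReal ENNReal Laplacian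

namespace Literature.Analysis.FluidPDE

namespace LeiZhang2011

/-- **The energy inequality (Lei–Zhang 2011, (2.4)) in time-integrated form.** In the setting
of `energy_identity` on `[t₁, t₂]` (axisymmetric `F(s,·) ∈ C²` vanishing on the axis, drifts
`b(s,·) = curl B(s,·)` a.e., the equation in time-integrated form off the axis, the space–time
integrability hypothesis), assume moreover: `H ≥ 0` convex with `H'² ≤ κ H H''`, `κ ≥ 0`; the
cut-off satisfies `φ ∂ᵣφ ≤ 0`; `η ≥ 0` on `[t₁, t₂]` with `η(t₁) = 0`; `0 < ε`; and the slice
functionals `G(s) = ∫ H''(F)‖∇F‖²φ²`, `T₁(s) = ∫ H'(F)⟪∇F,∇φ²⟫`, `T₂(s) = ∫ H(F)⟪b,∇φ²⟫`,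
`T₃(s) = ∫ (2/r)H(F)∂ᵣφ²`, `M(s) = ∫ H(F)φ²`, `P(s) = ∫ H(F)‖∇φ‖²`,
`Q(s) = ∫ H(F)‖B − c‖²‖∇φ‖²` are integrable on `[t₁, t₂]`. Then
`η(t₂) M(t₂) + (1 − 2ε) ∫_{t₁}^{t₂} η G ≤ ∫_{t₁}^{t₂} (η (κ/ε) (P + Q) + |η'| M) ds`. [cite: LeiZhang2011, §2 (2.3)–(2.4) (arXiv:1011.5066 pp. 6–7)] -/
theorem energy_inequality {F N : ℝ → EuclideanSpace ℝ (Fin 3) → ℝ}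
    {b Bst : ℝ → EuclideanSpace ℝ (Fin 3) → EuclideanSpace ℝ (Fin 3)}
    {c : ℝ → EuclideanSpace ℝ (Fin 3)} {t₁ t₂ : ℝ} (ht : t₁ ≤ t₂)
    (hF2 : ∀ s, ContDiff ℝ 2 (F s)) (hFa : ∀ s, IsAxisymmetricScalar (F s))
    (hF0 : ∀ s x, cylRadius x = 0 → F s x = 0)
    (hb : ∀ s, LocallyIntegrable (b s) volume)
    (hBst : ∀ s ∈ Ioc t₁ t₂, Differentiable ℝ (Bst s) ∧ curl (Bst s) =ᵐ[volume] b s)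
    (hN : ∀ s x, N s x =
      (Δ (F s)) x - fderiv ℝ (F s) x (b s x) - 2 / cylRadius x * fderiv ℝ (F s) x (eR x))
    (heq : ∀ᵐ x ∂(volume : Measure (EuclideanSpace ℝ (Fin 3))),
      IntervalIntegrable (fun s => N s x) volume t₁ t₂ ∧
        ∀ s ∈ Icc t₁ t₂, F s x = F t₁ x + ∫ τ in t₁..s, N τ x)
    {H : ℝ → ℝ} (hH : ContDiff ℝ 2 H) (hH00 : H 0 = 0) (hH0 : ∀ v, 0 ≤ H v)
    (hH2 : ∀ v, 0 ≤ deriv (deriv H) v) {κ : ℝ} (hκ0 : 0 ≤ κ)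
    (hκ : ∀ v, deriv H v ^ 2 ≤ κ * H v * deriv (deriv H) v)
    {φ : EuclideanSpace ℝ (Fin 3) → ℝ} (hφ : ContDiff ℝ 2 φ) (hφc : HasCompactSupport φ)
    (hφa : IsAxisymmetricScalar φ) (hφr : ∀ x, φ x * fderiv ℝ φ x (eR x) ≤ 0)
    {η : ℝ → ℝ} (hη : ContDiff ℝ 1 η) (hη0 : ∀ s ∈ Icc t₁ t₂, 0 ≤ η s) (hη1 : η t₁ = 0)
    {ε : ℝ} (hε : 0 < ε)
    (hint : Integrable (fun p : ℝ × EuclideanSpace ℝ (Fin 3) =>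
      (deriv H (F p.1 p.2) * N p.1 p.2 * η p.1 + H (F p.1 p.2) * deriv η p.1) * φ p.2 ^ 2)
      ((volume.restrict (Ioc t₁ t₂)).prod volume))
    -- the slice functionals and their integrability in time
    {G T₁ T₂ T₃ M P Q : ℝ → ℝ}
    (hG : ∀ s, G s = ∫ x, deriv (deriv H) (F s x) * ‖gradient (F s) x‖ ^ 2 * φ x ^ 2)
    (hT₁ : ∀ s, T₁ s = ∫ x, deriv H (F s x) * ⟪gradient (F s) x, gradient (fun y => φ y ^ 2) x⟫)
    (hT₂ : ∀ s, T₂ s = ∫ x, H (F s x) * ⟪b s x, gradient (fun y => φ y ^ 2) x⟫)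
    (hT₃ : ∀ s, T₃ s = ∫ x, 2 / cylRadius x * (H (F s x) * fderiv ℝ (fun y => φ y ^ 2) x (eR x)))
    (hM : ∀ s, M s = ∫ x, H (F s x) * φ x ^ 2)
    (hP : ∀ s, P s = ∫ x, H (F s x) * ‖gradient φ x‖ ^ 2)
    (hQ : ∀ s, Q s = ∫ x, H (F s x) * ‖Bst s x - c s‖ ^ 2 * ‖gradient φ x‖ ^ 2)
    (hGi : IntervalIntegrable G volume t₁ t₂) (hT₁i : IntervalIntegrable T₁ volume t₁ t₂)
    (hT₂i : IntervalIntegrable T₂ volume t₁ t₂) (hT₃i : IntervalIntegrable T₃ volume t₁ t₂)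
    (hMi : IntervalIntegrable M volume t₁ t₂) (hPi : IntervalIntegrable P volume t₁ t₂)
    (hQi : IntervalIntegrable Q volume t₁ t₂) :
    η t₂ * M t₂ + (1 - 2 * ε) * ∫ s in t₁..t₂, η s * G s ≤
      ∫ s in t₁..t₂, (η s * (κ / ε) * (P s + Q s) + |deriv η s| * M s) := by
  -- continuity (hence boundedness on `[t₁, t₂]`) of `η`, `η'`
  have hηc : Continuous η := hη.continuous
  have hη'c : Continuous (deriv η) := hη.continuous_deriv le_rfl
  -- Step 1: the identity, with `η(t₁) = 0`
  have hBst' : ∀ᵐ s ∂(volume.restrict (Ioc t₁ t₂)),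
      Differentiable ℝ (Bst s) ∧ curl (Bst s) =ᵐ[volume] b s :=
    (ae_restrict_iff' measurableSet_Ioc).2 (Eventually.of_forall hBst)
  have hid := energy_identity ht hF2 hFa hF0 hb hBst' hN heq hH hH00 hφ hφc hφa hη hint
  have hLHS : ∫ x, (H (F t₂ x) * η t₂ - H (F t₁ x) * η t₁) * φ x ^ 2 = η t₂ * M t₂ := by
    rw [hM t₂, ← MeasureTheory.integral_const_mul]
    refine integral_congr_ae (Eventually.of_forall fun x => ?_)
    simp only [hη1]
    ring
  rw [hLHS] at hid
  -- regularity facts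
  have hH' : ContDiff ℝ 1 (deriv H) := by
    have h2 : ContDiff ℝ (1 + 1) H := by rw [one_add_one_eq_two]; exact hH
    exact h2.deriv'
  have hH'' : Continuous (deriv (deriv H)) := hH'.continuous_deriv le_rfl
  have hφ1 : ContDiff ℝ 1 φ := hφ.of_le (by norm_num)
  have hφ2c : HasCompactSupport fun y => φ y ^ 2 :=
    hφc.comp_left (g := fun t : ℝ => t ^ 2) (by simp)
  have hgradφ : Continuous (gradient φ) := continuous_gradient_of_contDiff hφ1
  have hgradφ2 : Continuous (gradient fun y => φ y ^ 2) :=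
    continuous_gradient_of_contDiff ((hφ.pow 2).of_le (by norm_num))
  have hgradφ2c : HasCompactSupport (gradient fun y => φ y ^ 2) :=
    HasCompactSupport.intro hφ2c fun x hx => gradient_eq_zero_of_notMem_tsupport hx
  -- integrability of the two pieces of the viscous term, at each time
  have hiG : ∀ s, Integrable (fun x => deriv (deriv H) (F s x) * ‖gradient (F s) x‖ ^ 2 * φ x ^ 2)
      (volume : Measure (EuclideanSpace ℝ (Fin 3))) := fun s =>
    (((hH''.comp (hF2 s).continuous).mul
      ((continuous_gradient_of_contDiff ((hF2 s).of_le (by norm_num))).norm.pow 2)).mul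
        (hφ.continuous.pow 2)).integrable_of_hasCompactSupport hφ2c.mul_left
  have hiT : ∀ s, Integrable (fun x =>
      deriv H (F s x) * ⟪gradient (F s) x, gradient (fun y => φ y ^ 2) x⟫)
      (volume : Measure (EuclideanSpace ℝ (Fin 3))) := fun s =>
    (((hH.continuous_deriv (by norm_num)).comp (hF2 s).continuous).mul
      ((continuous_gradient_of_contDiff ((hF2 s).of_le (by norm_num))).inner hgradφ2)).integrable_of_hasCompactSupport
        (hgradφ2c.mono fun x hx => by
          contrapose! hx
          simp only [mem_support, not_not] at hx ⊢
          show deriv H (F s x) * ⟪gradient (F s) x, gradient (fun y => φ y ^ 2) x⟫ = 0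
          rw [hx, inner_zero_right, mul_zero])
  -- rewrite the identity's integrand through the slice functionals
  have hid' : η t₂ * M t₂ =
      ∫ s in t₁..t₂, (η s * (-(G s + T₁ s) + T₂ s + T₃ s) + deriv η s * M s) := by
    rw [hid]
    refine intervalIntegral.integral_congr fun s _ => ?_
    have hsplit : ∫ x, (deriv (deriv H) (F s x) * ‖gradient (F s) x‖ ^ 2 * φ x ^ 2 +
        deriv H (F s x) * ⟪gradient (F s) x, gradient (fun y => φ y ^ 2) x⟫) = G s + T₁ s := by
      rw [hG s, hT₁ s, ← integral_add (hiG s) (hiT s)]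
    simp only [hsplit, ← hT₂ s, ← hT₃ s, ← hM s]
  -- Step 2: the pointwise-in-time bound of the integrand, for a.e. `s ∈ (t₁, t₂]`
  have hMnn : ∀ s, 0 ≤ M s := fun s => by
    rw [hM s]; exact integral_nonneg fun x => mul_nonneg (hH0 _) (sq_nonneg _)
  have hbound : ∀ s ∈ Ioc t₁ t₂,
      η s * (-(G s + T₁ s) + T₂ s + T₃ s) + deriv η s * M s ≤
        -((1 - 2 * ε) * (η s * G s)) + (η s * (κ / ε) * (P s + Q s) + |deriv η s| * M s) := by
    intro s hs
    have hηs : 0 ≤ η s := hη0 s (Ioc_subset_Icc_self hs)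
    obtain ⟨hBd, hBcurl⟩ := hBst s hs
    -- `−T₁ ≤ εG + (κ/ε)P`
    have h1 : -T₁ s ≤ ε * G s + κ / ε * P s := by
      have h := abs_integral_deriv_comp_inner_gradient_le ((hF2 s).of_le (by norm_num)) hH hH0 hH2
        hκ0 hκ hφ1 hφc hε
      rw [← hT₁ s, ← hG s, ← hP s] at h
      linarith [neg_abs_le (T₁ s)]
    -- `T₂ ≤ εG + (κ/ε)Q`
    have h2 : T₂ s ≤ ε * G s + κ / ε * Q s := by
      have h := integral_comp_inner_gradient_sq_le (hF2 s) hH hH0 hH2 hκ0 hκ hφ hφc hBd hBcurl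
        (hb s) (c s) hε
      rwa [← hT₂ s, ← hG s, ← hQ s] at h
    -- `T₃ ≤ 0`
    have h3 : T₃ s ≤ 0 := by
      rw [hT₃ s]
      exact integral_axis_term_nonpos (F := F s) hH0 (hφ.differentiable two_ne_zero) hφr
    -- `η' M ≤ |η'| M`
    have h4 : deriv η s * M s ≤ |deriv η s| * M s :=
      mul_le_mul_of_nonneg_right (le_abs_self _) (hMnn s)
    have h5 : η s * (-(G s + T₁ s) + T₂ s + T₃ s) ≤
        η s * (-G s + (ε * G s + κ / ε * P s) + (ε * G s + κ / ε * Q s)) :=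
      mul_le_mul_of_nonneg_left (by linarith) hηs
    calc η s * (-(G s + T₁ s) + T₂ s + T₃ s) + deriv η s * M s
        ≤ η s * (-G s + (ε * G s + κ / ε * P s) + (ε * G s + κ / ε * Q s)) + |deriv η s| * M s :=
          add_le_add h5 h4
      _ = -((1 - 2 * ε) * (η s * G s)) + (η s * (κ / ε) * (P s + Q s) + |deriv η s| * M s) := by
          ring
  -- Step 3: integrate the bound over `[t₁, t₂]`
  have hηi : ∀ {f : ℝ → ℝ}, IntervalIntegrable f volume t₁ t₂ →
      IntervalIntegrable (fun s => η s * f s) volume t₁ t₂ := fun hf =>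
    hf.continuousOn_mul hηc.continuousOn
  have hη'i : ∀ {f : ℝ → ℝ}, IntervalIntegrable f volume t₁ t₂ →
      IntervalIntegrable (fun s => |deriv η s| * f s) volume t₁ t₂ := fun hf =>
    hf.continuousOn_mul hη'c.abs.continuousOn
  have hLi : IntervalIntegrable (fun s => η s * (-(G s + T₁ s) + T₂ s + T₃ s) + deriv η s * M s)
      volume t₁ t₂ :=
    (hηi (((hGi.add hT₁i).neg.add hT₂i).add hT₃i)).add (hMi.continuousOn_mul hη'c.continuousOn)
  have hRi : IntervalIntegrable (fun s => -((1 - 2 * ε) * (η s * G s)) +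
      (η s * (κ / ε) * (P s + Q s) + |deriv η s| * M s)) volume t₁ t₂ := by
    refine ((hηi hGi).const_mul (1 - 2 * ε)).neg.add ?_
    refine IntervalIntegrable.add ?_ (hη'i hMi)
    have h := (hηi (hPi.add hQi)).const_mul (κ / ε)
    refine h.congr_ae ?_
    exact Eventually.of_forall fun s => by ring
  have hmono : ∫ s in t₁..t₂, (η s * (-(G s + T₁ s) + T₂ s + T₃ s) + deriv η s * M s) ≤
      ∫ s in t₁..t₂, (-((1 - 2 * ε) * (η s * G s)) +
        (η s * (κ / ε) * (P s + Q s) + |deriv η s| * M s)) := by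
    refine intervalIntegral.integral_mono_ae_restrict ht hLi hRi ?_
    have hne : ∀ᵐ s ∂(volume : Measure ℝ), s ≠ t₁ := by
      rw [ae_iff]
      simp
    refine (ae_restrict_iff' measurableSet_Icc).2 ?_
    filter_upwards [hne] with s hs hsI
    exact hbound s ⟨lt_of_le_of_ne hsI.1 (Ne.symm hs), hsI.2⟩
  have hsplit : ∫ s in t₁..t₂, (-((1 - 2 * ε) * (η s * G s)) +
      (η s * (κ / ε) * (P s + Q s) + |deriv η s| * M s)) =
      -((1 - 2 * ε) * ∫ s in t₁..t₂, η s * G s) +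
        ∫ s in t₁..t₂, (η s * (κ / ε) * (P s + Q s) + |deriv η s| * M s) := by
    have hf' : IntervalIntegrable (fun s => -((1 - 2 * ε) * (η s * G s))) volume t₁ t₂ :=
      ((hηi hGi).const_mul (1 - 2 * ε)).neg
    have hg₁ : IntervalIntegrable (fun s => η s * (κ / ε) * (P s + Q s)) volume t₁ t₂ :=
      ((hηi (hPi.add hQi)).const_mul (κ / ε)).congr_ae (Eventually.of_forall fun s => by ring)
    have hg' : IntervalIntegrable (fun s => η s * (κ / ε) * (P s + Q s) + |deriv η s| * M s)
        volume t₁ t₂ := hg₁.add (hη'i hMi)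
    rw [intervalIntegral.integral_add hf' hg', intervalIntegral.integral_neg,
      intervalIntegral.integral_const_mul]
  rw [hsplit] at hmono
  linarith [hid'.symm.le, hid'.le]

/-- **The energy inequality (Lei–Zhang 2011, (2.4)) in time-integrated form, majorant version.**
Same as `energy_inequality`, but the cut-off terms `(κ/ε) η (P + Q) + |η'| M` of the right-hand
side are only assumed to be bounded, for `s ∈ (t₁, t₂]`, by an integrable majorant `Rm` (the
stream function `B(s,·)` need not depend measurably on `s`, so `Q` itself need not be
measurable; in the application `Q(s)` is bounded slice-wise by the John–Nirenberg inequality). In the setting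
of `energy_identity` on `[t₁, t₂]` (axisymmetric `F(s,·) ∈ C²` vanishing on the axis, drifts
`b(s,·) = curl B(s,·)` a.e., the equation in time-integrated form off the axis, the space–time
integrability hypothesis), assume moreover: `H ≥ 0` convex with `H'² ≤ κ H H''`, `κ ≥ 0`; the
cut-off satisfies `φ ∂ᵣφ ≤ 0`; `η ≥ 0` on `[t₁, t₂]` with `η(t₁) = 0`; `0 < ε`; and the slice
functionals `G(s) = ∫ H''(F)‖∇F‖²φ²`, `T₁(s) = ∫ H'(F)⟪∇F,∇φ²⟫`, `T₂(s) = ∫ H(F)⟪b,∇φ²⟫`,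
`T₃(s) = ∫ (2/r)H(F)∂ᵣφ²`, `M(s) = ∫ H(F)φ²`, `P(s) = ∫ H(F)‖∇φ‖²`,
`Q(s) = ∫ H(F)‖B − c‖²‖∇φ‖²` are integrable on `[t₁, t₂]`. Then
`η(t₂) M(t₂) + (1 − 2ε) ∫_{t₁}^{t₂} η G ≤ ∫_{t₁}^{t₂} (η (κ/ε) (P + Q) + |η'| M) ds`. [cite: LeiZhang2011, §2 (2.3)–(2.4) (arXiv:1011.5066 pp. 6–7)] -/
theorem energy_inequality_of_majorant {F N : ℝ → EuclideanSpace ℝ (Fin 3) → ℝ}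
    {b Bst : ℝ → EuclideanSpace ℝ (Fin 3) → EuclideanSpace ℝ (Fin 3)}
    {c : ℝ → EuclideanSpace ℝ (Fin 3)} {t₁ t₂ : ℝ} (ht : t₁ ≤ t₂)
    (hF2 : ∀ s, ContDiff ℝ 2 (F s)) (hFa : ∀ s, IsAxisymmetricScalar (F s))
    (hF0 : ∀ s x, cylRadius x = 0 → F s x = 0)
    (hb : ∀ s, LocallyIntegrable (b s) volume)
    (hBst : ∀ᵐ s ∂(volume.restrict (Ioc t₁ t₂)),
      Differentiable ℝ (Bst s) ∧ curl (Bst s) =ᵐ[volume] b s)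
    (hN : ∀ s x, N s x =
      (Δ (F s)) x - fderiv ℝ (F s) x (b s x) - 2 / cylRadius x * fderiv ℝ (F s) x (eR x))
    (heq : ∀ᵐ x ∂(volume : Measure (EuclideanSpace ℝ (Fin 3))),
      IntervalIntegrable (fun s => N s x) volume t₁ t₂ ∧
        ∀ s ∈ Icc t₁ t₂, F s x = F t₁ x + ∫ τ in t₁..s, N τ x)
    {H : ℝ → ℝ} (hH : ContDiff ℝ 2 H) (hH00 : H 0 = 0) (hH0 : ∀ v, 0 ≤ H v)
    (hH2 : ∀ v, 0 ≤ deriv (deriv H) v) {κ : ℝ} (hκ0 : 0 ≤ κ)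
    (hκ : ∀ v, deriv H v ^ 2 ≤ κ * H v * deriv (deriv H) v)
    {φ : EuclideanSpace ℝ (Fin 3) → ℝ} (hφ : ContDiff ℝ 2 φ) (hφc : HasCompactSupport φ)
    (hφa : IsAxisymmetricScalar φ) (hφr : ∀ x, φ x * fderiv ℝ φ x (eR x) ≤ 0)
    {η : ℝ → ℝ} (hη : ContDiff ℝ 1 η) (hη0 : ∀ s ∈ Icc t₁ t₂, 0 ≤ η s) (hη1 : η t₁ = 0)
    {ε : ℝ} (hε : 0 < ε)
    (hint : Integrable (fun p : ℝ × EuclideanSpace ℝ (Fin 3) =>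
      (deriv H (F p.1 p.2) * N p.1 p.2 * η p.1 + H (F p.1 p.2) * deriv η p.1) * φ p.2 ^ 2)
      ((volume.restrict (Ioc t₁ t₂)).prod volume))
    -- the slice functionals and their integrability in time
    {G T₁ T₂ T₃ M : ℝ → ℝ}
    (hG : ∀ s, G s = ∫ x, deriv (deriv H) (F s x) * ‖gradient (F s) x‖ ^ 2 * φ x ^ 2)
    (hT₁ : ∀ s, T₁ s = ∫ x, deriv H (F s x) * ⟪gradient (F s) x, gradient (fun y => φ y ^ 2) x⟫)
    (hT₂ : ∀ s, T₂ s = ∫ x, H (F s x) * ⟪b s x, gradient (fun y => φ y ^ 2) x⟫)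
    (hT₃ : ∀ s, T₃ s = ∫ x, 2 / cylRadius x * (H (F s x) * fderiv ℝ (fun y => φ y ^ 2) x (eR x)))
    (hM : ∀ s, M s = ∫ x, H (F s x) * φ x ^ 2)
    (hGi : IntervalIntegrable G volume t₁ t₂) (hT₁i : IntervalIntegrable T₁ volume t₁ t₂)
    (hT₂i : IntervalIntegrable T₂ volume t₁ t₂) (hT₃i : IntervalIntegrable T₃ volume t₁ t₂)
    (hMi : IntervalIntegrable M volume t₁ t₂)
    -- the majorant of the cut-off terms
    {Rm : ℝ → ℝ}
    (hR : ∀ᵐ s ∂(volume.restrict (Ioc t₁ t₂)),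
      η s * (κ / ε) * ((∫ x, H (F s x) * ‖gradient φ x‖ ^ 2) +
        ∫ x, H (F s x) * ‖Bst s x - c s‖ ^ 2 * ‖gradient φ x‖ ^ 2) + |deriv η s| * M s ≤ Rm s)
    (hRi : IntervalIntegrable Rm volume t₁ t₂) :
    η t₂ * M t₂ + (1 - 2 * ε) * ∫ s in t₁..t₂, η s * G s ≤ ∫ s in t₁..t₂, Rm s := by
  -- continuity (hence boundedness on `[t₁, t₂]`) of `η`, `η'`
  have hηc : Continuous η := hη.continuous
  have hη'c : Continuous (deriv η) := hη.continuous_deriv le_rfl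
  -- Step 1: the identity, with `η(t₁) = 0`
  have hid := energy_identity ht hF2 hFa hF0 hb hBst hN heq hH hH00 hφ hφc hφa hη hint
  have hLHS : ∫ x, (H (F t₂ x) * η t₂ - H (F t₁ x) * η t₁) * φ x ^ 2 = η t₂ * M t₂ := by
    rw [hM t₂, ← MeasureTheory.integral_const_mul]
    refine integral_congr_ae (Eventually.of_forall fun x => ?_)
    simp only [hη1]
    ring
  rw [hLHS] at hid
  -- regularity facts
  have hH' : ContDiff ℝ 1 (deriv H) := by
    have h2 : ContDiff ℝ (1 + 1) H := by rw [one_add_one_eq_two]; exact hH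
    exact h2.deriv'
  have hH'' : Continuous (deriv (deriv H)) := hH'.continuous_deriv le_rfl
  have hφ1 : ContDiff ℝ 1 φ := hφ.of_le (by norm_num)
  have hφ2c : HasCompactSupport fun y => φ y ^ 2 :=
    hφc.comp_left (g := fun t : ℝ => t ^ 2) (by simp)
  have hgradφ : Continuous (gradient φ) := continuous_gradient_of_contDiff hφ1
  have hgradφ2 : Continuous (gradient fun y => φ y ^ 2) :=
    continuous_gradient_of_contDiff ((hφ.pow 2).of_le (by norm_num))
  have hgradφ2c : HasCompactSupport (gradient fun y => φ y ^ 2) :=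
    HasCompactSupport.intro hφ2c fun x hx => gradient_eq_zero_of_notMem_tsupport hx
  -- integrability of the two pieces of the viscous term, at each time
  have hiG : ∀ s, Integrable (fun x => deriv (deriv H) (F s x) * ‖gradient (F s) x‖ ^ 2 * φ x ^ 2)
      (volume : Measure (EuclideanSpace ℝ (Fin 3))) := fun s =>
    (((hH''.comp (hF2 s).continuous).mul
      ((continuous_gradient_of_contDiff ((hF2 s).of_le (by norm_num))).norm.pow 2)).mul
        (hφ.continuous.pow 2)).integrable_of_hasCompactSupport hφ2c.mul_left
  have hiT : ∀ s, Integrable (fun x =>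
      deriv H (F s x) * ⟪gradient (F s) x, gradient (fun y => φ y ^ 2) x⟫)
      (volume : Measure (EuclideanSpace ℝ (Fin 3))) := fun s =>
    (((hH.continuous_deriv (by norm_num)).comp (hF2 s).continuous).mul
      ((continuous_gradient_of_contDiff ((hF2 s).of_le (by norm_num))).inner hgradφ2)).integrable_of_hasCompactSupport
        (hgradφ2c.mono fun x hx => by
          contrapose! hx
          simp only [mem_support, not_not] at hx ⊢
          show deriv H (F s x) * ⟪gradient (F s) x, gradient (fun y => φ y ^ 2) x⟫ = 0
          rw [hx, inner_zero_right, mul_zero])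
  -- rewrite the identity's integrand through the slice functionals
  have hid' : η t₂ * M t₂ =
      ∫ s in t₁..t₂, (η s * (-(G s + T₁ s) + T₂ s + T₃ s) + deriv η s * M s) := by
    rw [hid]
    refine intervalIntegral.integral_congr fun s _ => ?_
    have hsplit : ∫ x, (deriv (deriv H) (F s x) * ‖gradient (F s) x‖ ^ 2 * φ x ^ 2 +
        deriv H (F s x) * ⟪gradient (F s) x, gradient (fun y => φ y ^ 2) x⟫) = G s + T₁ s := by
      rw [hG s, hT₁ s, ← integral_add (hiG s) (hiT s)]
    simp only [hsplit, ← hT₂ s, ← hT₃ s, ← hM s]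
  -- Step 2: the pointwise-in-time bound of the integrand, for a.e. `s ∈ (t₁, t₂]`
  have hMnn : ∀ s, 0 ≤ M s := fun s => by
    rw [hM s]; exact integral_nonneg fun x => mul_nonneg (hH0 _) (sq_nonneg _)
  have hbound : ∀ᵐ s ∂(volume.restrict (Ioc t₁ t₂)),
      η s * (-(G s + T₁ s) + T₂ s + T₃ s) + deriv η s * M s ≤
        -((1 - 2 * ε) * (η s * G s)) + Rm s := by
    filter_upwards [hBst, hR, ae_restrict_mem measurableSet_Ioc] with s hBs hRs hs
    have hηs : 0 ≤ η s := hη0 s (Ioc_subset_Icc_self hs)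
    obtain ⟨hBd, hBcurl⟩ := hBs
    set Ps : ℝ := ∫ x, H (F s x) * ‖gradient φ x‖ ^ 2 with hPs
    set Qs : ℝ := ∫ x, H (F s x) * ‖Bst s x - c s‖ ^ 2 * ‖gradient φ x‖ ^ 2 with hQs
    -- `−T₁ ≤ εG + (κ/ε)P`
    have h1 : -T₁ s ≤ ε * G s + κ / ε * Ps := by
      have h := abs_integral_deriv_comp_inner_gradient_le ((hF2 s).of_le (by norm_num)) hH hH0 hH2
        hκ0 hκ hφ1 hφc hε
      rw [← hT₁ s, ← hG s] at h
      linarith [neg_abs_le (T₁ s)]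
    -- `T₂ ≤ εG + (κ/ε)Q`
    have h2 : T₂ s ≤ ε * G s + κ / ε * Qs := by
      have h := integral_comp_inner_gradient_sq_le (hF2 s) hH hH0 hH2 hκ0 hκ hφ hφc hBd hBcurl
        (hb s) (c s) hε
      rwa [← hT₂ s, ← hG s] at h
    -- `T₃ ≤ 0`
    have h3 : T₃ s ≤ 0 := by
      rw [hT₃ s]
      exact integral_axis_term_nonpos (F := F s) hH0 (hφ.differentiable two_ne_zero) hφr
    -- `η' M ≤ |η'| M`
    have h4 : deriv η s * M s ≤ |deriv η s| * M s :=
      mul_le_mul_of_nonneg_right (le_abs_self _) (hMnn s)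
    have h5 : η s * (-(G s + T₁ s) + T₂ s + T₃ s) ≤
        η s * (-G s + (ε * G s + κ / ε * Ps) + (ε * G s + κ / ε * Qs)) :=
      mul_le_mul_of_nonneg_left (by linarith) hηs
    calc η s * (-(G s + T₁ s) + T₂ s + T₃ s) + deriv η s * M s
        ≤ η s * (-G s + (ε * G s + κ / ε * Ps) + (ε * G s + κ / ε * Qs)) + |deriv η s| * M s :=
          add_le_add h5 h4
      _ = -((1 - 2 * ε) * (η s * G s)) + (η s * (κ / ε) * (Ps + Qs) + |deriv η s| * M s) := by
          ring
      _ ≤ -((1 - 2 * ε) * (η s * G s)) + Rm s := by linarith [hRs]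
  -- Step 3: integrate the bound over `[t₁, t₂]`
  have hηi : ∀ {f : ℝ → ℝ}, IntervalIntegrable f volume t₁ t₂ →
      IntervalIntegrable (fun s => η s * f s) volume t₁ t₂ := fun hf =>
    hf.continuousOn_mul hηc.continuousOn
  have hη'i : ∀ {f : ℝ → ℝ}, IntervalIntegrable f volume t₁ t₂ →
      IntervalIntegrable (fun s => |deriv η s| * f s) volume t₁ t₂ := fun hf =>
    hf.continuousOn_mul hη'c.abs.continuousOn
  have hLi : IntervalIntegrable (fun s => η s * (-(G s + T₁ s) + T₂ s + T₃ s) + deriv η s * M s)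
      volume t₁ t₂ :=
    (hηi (((hGi.add hT₁i).neg.add hT₂i).add hT₃i)).add (hMi.continuousOn_mul hη'c.continuousOn)
  have hRi' : IntervalIntegrable (fun s => -((1 - 2 * ε) * (η s * G s)) + Rm s) volume t₁ t₂ :=
    ((hηi hGi).const_mul (1 - 2 * ε)).neg.add hRi
  have hmono : ∫ s in t₁..t₂, (η s * (-(G s + T₁ s) + T₂ s + T₃ s) + deriv η s * M s) ≤
      ∫ s in t₁..t₂, (-((1 - 2 * ε) * (η s * G s)) + Rm s) := by
    refine intervalIntegral.integral_mono_ae_restrict ht hLi hRi' ?_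
    have hI : (volume : Measure ℝ).restrict (Icc t₁ t₂) = volume.restrict (Ioc t₁ t₂) :=
      Measure.restrict_congr_set Ioc_ae_eq_Icc.symm
    rw [Filter.EventuallyLE, hI]
    exact hbound
  have hsplit : ∫ s in t₁..t₂, (-((1 - 2 * ε) * (η s * G s)) + Rm s) =
      -((1 - 2 * ε) * ∫ s in t₁..t₂, η s * G s) + ∫ s in t₁..t₂, Rm s := by
    have hf' : IntervalIntegrable (fun s => -((1 - 2 * ε) * (η s * G s))) volume t₁ t₂ :=
      ((hηi hGi).const_mul (1 - 2 * ε)).neg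
    rw [intervalIntegral.integral_add hf' hRi, intervalIntegral.integral_neg,
      intervalIntegral.integral_const_mul]
  rw [hsplit] at hmono
  linarith [hid'.symm.le, hid'.le]

end LeiZhang2011

end Literature.Analysis.FluidPDE
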